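import Mathlib.NumberTheory.Harmonic.EulerMascheroni
import Mathlib.NumberTheory.ArithmeticFunction.Moebius
import Literature.NumberTheory.LFunctions.FamilyNonvanishingLandauSiegel
import HarnessLib

/-!
# Non-vanishing of automorphic `L`-functions of prime power level
# (Balkanova–Frolenkov, Monatsh. Math. 185 (2018), §1: Theorems 1.1, 1.5, 1.6, 1.7)

Topic `Literature/NumberTheory/LFunctions` (namespace `Literature.NumberTheory.LFunctions`; the
paper's internal objects live in the sub-namespace `BalkanovaFrolenkov2017`, the generic family
vocabulary it adds in `IwaniecSarnak`, continuing `FamilyNonvanishingLandauSiegel.lean`).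
STATEMENT LAYER (D-0014): four NAMED FACTS (`def … : Prop`, theorems in print, not proved here) —
Theorem 1.1 (both clauses), Theorem 1.5, Theorem 1.6, Theorem 1.7 (in its printed combined form) —
over REAL definitions: the normalised Hecke eigenvalues `λ_f(n)`, the analytically normalised
`L`-function `L_f(s)`, the `ℂ`-valued harmonic sum `Σ^h`, and the paper's `φ_ν(N)`, `τ_{it}(r)`,
twisted moments `M₁(l,0,it)`, `M₂(l,0,it)` and the main term of Theorem 1.5. Typed for the cell
`landau-siegel` (LS programme §C harvest rows T-020 / T-021; tags E*-fam — the harmonic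
proportion `c = ¼` is Iwaniec–Sarnak's natural barrier in the whole-family normalisation — and
E*-len as INPUT: the admissible logarithmic mollifier lengths `Ω < ½` for `M₂`, `Ω < 1` for `M₁`
are exactly the diagonal ranges these asymptotics certify).

## What the source prints (held text `paper:arxiv-1605.02434`, corpus-tex, 15 chunks, read 2026-08-26)

O. Balkanova, D. Frolenkov, *Non-vanishing of automorphic `L`-functions of prime power level*,
Monatsh. Math. **185** (2018) 17–41 = arXiv:1605.02434 [BalkanovaFrolenkov2017].

**§1, standing data** (p0002–p0003:L55). `H*_{2k}(N)` = primitive newforms of level `N`, weight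
`2k`, with `⟨f,g⟩_N := ∫_{F₀(N)} f ḡ y^k dxdy/y²` (1.1);
`f(z) = Σ_{n≥1} λ_f(n) n^{(2k−1)/2} e(nz)` (1.2); `L_f(s) = Σ λ_f(n) n^{−s}`, `Re s > 1` (1.4);
`Λ_f(s) = (√N/2π)^s Γ(s + (2k−1)/2) L_f(s) = ε_f Λ_f(1−s)` (1.5)–(1.6). "For `N` large enough the
harmonic proportion of non-vanishing is defined by `PN := Σ^h_{f ∈ H*_{2k}(N), L_f(1/2) ≠ 0} 1 ≥ c − ε`,
`ε > 0`. Subscript `h` indicates that the average is taken with the weight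
`Γ(2k−1)/((4π)^{2k−1}⟨f,f⟩_N)`." Records: "Iwaniec–Sarnak [IS]: `c = 1/4`, `N` is square-free and
`φ(N) ∼ N` … The value `c = 1/4` is a natural barrier. Iwaniec and Sarnak [IS] showed that if
inequality (pn) holds for some `c > 1/4` with an additional lower bound `L(1/2,f) ≥ 1/(log N)²`,
there are no Landau–Siegel zeros for Dirichlet `L`-functions of real primitive characters."

> **Theorem 1.1** (p0003:L76–L90). Let `N = p^ν`, `p` is a fixed prime. For any `ε > 0`,
> `Σ^h_{f ∈ H*_{2k}(N), L_f(1/2) ≠ 0} 1 ≥ (φ(N)/N)·(1/4) − ε` as `ν → ∞`.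
> Let `N = p^ν`, `ν ≥ 2` is fixed. For any `ε > 0`, `Σ^h_{f ∈ H*_{2k}(N), L_f(1/2) ≠ 0} 1 ≥ 1/4 − ε`
> as `p → ∞` over primes.
> (p0003:L92–L99) `M₁(l,u,v) = Σ^h_f λ_f(l) L_f(1/2+u+v)`, `M₂(l,u,v) = Σ^h_f λ_f(l) L_f(1/2+u+v) L_f(1/2+u−v)`.
> (p0004:L8–L15) `φ_ν(N) = 1 − p^{−1}` if `N = p^ν`, `ν ≥ 3`; `= 1 − (p − p^{−1})^{−1}` if `ν = 2`.

> **Theorem 1.5** (theorem 1.1 of [BalFrol]; p0004:L26–L45). Let `k ≥ 1`, `p` be a prime,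
> `t ∈ ℝ`, `T := 3 + |t|`, `N = p^ν` and `ν ≥ 2`. If `p ∣ l` then `M₂(l,0,it) = 0`. For `(l,p) = 1`
> we have `M₂(l,0,it) = (φ(N)φ_ν(N)/N)·(τ_{it}(l)/l^{1/2})·(log N + 2γ − 2 log 2π + 2 log p/(p−1)`
> `+ Γ′/Γ(k+it) + Γ′/Γ(k−it)) − (φ(N)φ_ν(N)/N)·l^{−(1/2−it)}·Σ_{d∣l} Σ_{r∣d} μ(d/r) τ_{it}(r) r^{−it} log r`
> `+ O_ε((lNT)^ε √l T/N)`, where `τ_{it}(r) = Σ_{ab=r} (a/b)^{it}`.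

> **Theorem 1.6** (particular case of theorem 1.1 of [Bet]; p0004:L47–L54). Let `2k = 2`,
> `t ∈ ℝ`, `T = 1 + |t|`, `N = p^ν`, `p` is a prime such and `ν ≥ 2`. If `p ∣ l` then
> `M₁(l,0,it) = 0`. For `(l,p) = 1` uniformly in `N`, `l`, `T`, `p`:
> `M₁(l,0,it) = φ_ν(N)/l^{1/2+it} + O_ε(√(lT) N^{−1+ε})`.

> **Theorem 1.7** (p0004:L56–L80). Let `2k ≥ 4`, `t ∈ ℝ`, `T = 1 + |t|`, `N = p^ν`, `p` is a prime
> and `ν ≥ 2`. If `p ∣ l` then `M₁(l,0,it) = 0`. For `(l,p) = 1` uniformly in `N, l, T, p` and `k`: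
> `M₁(l,0,it) = φ_ν(N)/l^{1/2+it} + O(V_N(l) + (1/p)V_{N/p}(l) + δ_{N,p²}/(√l p²))`, where
> `V_N(l) ≪ (1/√(lT))(2πe lT/(Nk))^k` for `l < Nk/(4πeT)` and
> `≪ (l^{1/2}/N)(lT)^ε max(√T/k, 1/√k)` for `l ≥ Nk/(4πeT)`. "Combining the last two estimates in
> one, we have `V_N(l) + (1/p)V_{N/p}(l) + δ_{N,p²}/(√l p²) ≪_{k,ε} l^{1/2+ε} T^{1/2+ε}/N`."

## Lean rendering / design choices (audit notes for ls-lit-ref)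

* `H*_{2k}(N)` = the tree's `newforms0 N (2k)` (weight parameter `2k : ℤ`, `k : ℕ`, `k ≥ 1`);
  `a_f(n) = cuspCoeff f n` and `λ_f(n) := a_f(n)/n^{(2k−1)/2}` (`IwaniecSarnak.heckeLambda`, for a
  form of weight `κ`: `a_f(n) n^{−(κ−1)/2}`). The harmonic weight `Γ(2k−1)/((4π)^{2k−1}⟨f,f⟩_N)` is
  VERBATIM the tree's `IwaniecSarnak.harmonicWeight` at weight `2k` (`⟨f,f⟩_N` = the tree's
  `peterssonProduct (Gamma0 N)`, the standard `∫ |f|² y^{2k} dμ`; the source's display (1.1) writes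
  `y^k` for weight `2k`, which we read as the standard Petersson norm — the normalisation under
  which, as the source uses throughout, `Σ^h_f 1 = φ_ν(N) + o(1)`, Lemma 1.4 with `m = n = 1`).
* `L_f(s)` (analytic normalisation, centre `½`) is `IwaniecSarnak.analyticL f s :=` the value at
  `s + (κ−1)/2` of the entire continuation `IwaniecSarnak.entireLSeries (cuspCoeff f) (κ/2+1)` of
  the classical `Σ a_f(n) n^{−s}` (`κ` the weight); `L_f(1/2) = IwaniecSarnak.centralValue f`
  (`analyticL_half`, proved). `L_f(1/2+it)L_f(1/2−it)` is rendered literally (it is `|L_f(1/2+it)|²`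
  for the real-coefficient newforms at hand; not used).
* `Σ^h` with COMPLEX summands (`λ_f(l) L_f(…)`) is `IwaniecSarnak.harmonicSumC` (same weight, `finsum`
  over `newforms0`); the real `harmonicSum` of the parent file is its restriction to real `X`
  (`harmonicSumC_ofReal`, proved).
* "`L_f(1/2) ≠ 0`" in Theorem 1.1: the indicator of `centralValue f ≠ 0` inside `harmonicSum`; the
  printed `PN ≥ c − ε` is an inequality between REAL numbers at each large `N` (no ratio: in this
  normalisation `Σ^h 1 → φ_ν(N)`). Clause (a): `k`, `p` fixed, `∀ ε ∃ ν₀ ∀ ν ≥ ν₀`; clause (b):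
  `k`, `ν ≥ 2` fixed, `∀ ε ∃ p₀ ∀ primes p ≥ p₀`. `N = p^ν` is carried as a hypothesis on a level
  `N` with `[NeZero N]` (the instance the tree's `newforms0` needs).
* `O_ε(…)` / `≪_{k,ε}`: `∀ k, ∀ ε > 0, ∃ C` — the constant may depend on `k` and `ε` (Theorem 1.5
  prints `O_ε` at fixed `k ≥ 1`; Theorem 1.7's combined bound prints `≪_{k,ε}`; Theorem 1.6 has
  `2k = 2` and `O_ε`), uniform in `N, l, T, p` (and `ν`) as printed. Theorem 1.7 is typed in the
  COMBINED form the source prints ("Combining the last two estimates in one"), i.e. with the error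
  `C·l^{1/2+ε}T^{1/2+ε}/N`; the sharper two-range bound for `V_N(l)` is quoted above, not typed.
* `φ(N)` = `Nat.totient`; `φ_ν(N)` = `BalkanovaFrolenkov2017.phiNu p ν`; `γ` =
  `Real.eulerMascheroniConstant`; `Γ′/Γ` = `deriv Complex.Gamma z / Complex.Gamma z`
  (`BalkanovaFrolenkov2017.digamma`); `μ` = `ArithmeticFunction.moebius`; `τ_{it}(r)` sums
  `(a/(r/a))^{it}` over the divisors `a` of `r`; `l^{−(1/2−it)}`, `r^{−it}`, `l^{1/2+it}` are complex
  powers of positive integers.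
* NOT typed: Lemma 1.2 / Theorem 1.3 (Rouymi), Lemma 1.4 (Rouymi's trace formula), (6.7) (the
  mollified proportion `((p−1)/p)·Ω/(1+2Ω) − ε`, an intermediate display of §6), the two-range
  bound for `V_N(l)`.

WHAT THIS IS NOT: no claim about Landau–Siegel zeros, about Theorems 1–2 of arXiv:2211.02515 or a
repaired `Margin232`; `c = ¼` here is a record AT the Iwaniec–Sarnak barrier, not beyond it. «The
programme SEARCHES and TYPES; no claim about Landau–Siegel zeros, Theorems 1–2 of arXiv:2211.02515
or a repaired Margin232 until a kernel theorem says so.»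

## References

* [BalkanovaFrolenkov2017] §1: (1.1)–(1.6), the harmonic weight (p0003:L54), Theorem 1.1,
  `M₁/M₂` (p0003:L92–L99), `φ_ν` (p0004:L8–L15), Theorems 1.5, 1.6, 1.7.
* [IwaniecSarnak2000] / [IwaniecConversations2006] §7 (the `c = ¼` barrier and its meaning).
* Tree: `FamilyNonvanishingLandauSiegel.lean` (`IwaniecSarnak.harmonicWeight`, `centralValue`,
  `entireLSeries`, `harmonicSum`), `Literature/NumberTheory/EllipticCurves/{CuspFormLFunction,Newforms}.lean`.
-/

noncomputable section

open scoped MatrixGroups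
open CongruenceSubgroup Complex Finset
open Literature.NumberTheory.EllipticCurves.ModularForms

namespace Literature.NumberTheory.LFunctions

/-! ### Generic family vocabulary (continuing `IwaniecSarnak`) -/

namespace IwaniecSarnak

variable {N : ℕ} [NeZero N] {κ : ℤ}

omit [NeZero N] in
/-- **The normalised Hecke eigenvalue `λ_f(n) = a_f(n) n^{−(κ−1)/2}`** of a form of weight `κ`
(`f(z) = Σ λ_f(n) n^{(κ−1)/2} e(nz)`; for a normalised newform `λ_f(1) = 1`). Junk at `n = 0`.
[cite: BalkanovaFrolenkov2017, §1 (1.2)] -/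
def heckeLambda (f : CuspForm (Gamma0 N) κ) (n : ℕ) : ℂ :=
  cuspCoeff f n / (n : ℂ) ^ (((κ : ℂ) - 1) / 2)

omit [NeZero N] in
/-- **`L_f(s) = Σ λ_f(n) n^{−s}` continued** (analytic normalisation, centre `s = ½`): the value at
`s + (κ−1)/2` of the entire continuation of the classical series `Σ a_f(n) n^{−s}` (convergent on
`re s > κ/2 + 1`). [cite: BalkanovaFrolenkov2017, §1 (1.4)–(1.6)] -/
def analyticL (f : CuspForm (Gamma0 N) κ) (s : ℂ) : ℂ :=
  entireLSeries (cuspCoeff f) ((κ : ℝ) / 2 + 1) (s + ((κ : ℂ) - 1) / 2)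

omit [NeZero N] in
/-- `L_f(1/2)` is the central value of the parent file. [cite: BalkanovaFrolenkov2017, §1 (1.6)] -/
theorem analyticL_half (f : CuspForm (Gamma0 N) κ) : analyticL f (1 / 2) = centralValue f := by
  unfold analyticL centralValue
  congr 1
  ring

variable (N κ) in
/-- **The harmonic sum `Σ^h_{f ∈ H*_κ(N)} X_f = Σ_f ω_f X_f` with complex summands** (weight
`ω_f = Γ(κ−1)/((4π)^{κ−1}⟨f,f⟩_N)` = `harmonicWeight`; `finsum` over `newforms0 N κ`).
[cite: BalkanovaFrolenkov2017, §1 (the weight after (1.7))] -/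
def harmonicSumC (X : CuspForm (Gamma0 N) κ → ℂ) : ℂ :=
  ∑ᶠ f ∈ newforms0 N κ, (harmonicWeight f : ℂ) * X f

/-- The real harmonic sum is the complex one on real summands.
[cite: BalkanovaFrolenkov2017, §1 (the weight after (1.7))] -/
theorem harmonicSumC_ofReal (X : CuspForm (Gamma0 N) κ → ℝ) :
    harmonicSumC N κ (fun f => ((X f : ℝ) : ℂ)) = ((harmonicSum N κ X : ℝ) : ℂ) := by
  unfold harmonicSumC harmonicSum
  have hinj : Function.Injective Complex.ofRealHom.toAddMonoidHom := Complex.ofReal_injective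
  have key : ∀ g : CuspForm (Gamma0 N) κ → ℝ,
      ((∑ᶠ f, g f : ℝ) : ℂ) = ∑ᶠ f, ((g f : ℝ) : ℂ) := fun g =>
    Complex.ofRealHom.toAddMonoidHom.map_finsum_of_injective hinj g
  rw [key]
  refine finsum_congr fun f => ?_
  have key' : ∀ g : f ∈ newforms0 N κ → ℝ,
      ((∑ᶠ h, g h : ℝ) : ℂ) = ∑ᶠ h, ((g h : ℝ) : ℂ) := fun g =>
    Complex.ofRealHom.toAddMonoidHom.map_finsum_of_injective hinj g
  rw [key']
  refine finsum_congr fun _ => ?_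
  push_cast
  ring

end IwaniecSarnak

open IwaniecSarnak

/-! ### The paper's objects -/

namespace BalkanovaFrolenkov2017

/-- **`φ_ν(N)`** for `N = p^ν`: `1 − p^{−1}` if `ν ≥ 3`, `1 − (p − p^{−1})^{−1}` if `ν = 2` (the
limit of `Σ^h_f 1`, Lemma 1.4). (For `ν ≤ 1`, not used, the `ν = 2` branch is returned.)
[cite: BalkanovaFrolenkov2017, §1 (display after Lemma 1.4)] -/
def phiNu (p ν : ℕ) : ℝ :=
  if 3 ≤ ν then 1 - (p : ℝ)⁻¹ else 1 - ((p : ℝ) - (p : ℝ)⁻¹)⁻¹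

/-- **`τ_{it}(r) = Σ_{ab = r} (a/b)^{it}`** (sum over the divisors `a` of `r`, `b = r/a`).
[cite: BalkanovaFrolenkov2017, Theorem 1.5 (definition of τ_{it})] -/
def tauIt (t : ℝ) (r : ℕ) : ℂ :=
  ∑ a ∈ r.divisors, (((a : ℝ) / ((r / a : ℕ) : ℝ) : ℝ) : ℂ) ^ ((t : ℂ) * I)

/-- `Γ′/Γ(z)`, the logarithmic derivative of `Γ`. [cite: BalkanovaFrolenkov2017, Theorem 1.5] -/
def digamma (z : ℂ) : ℂ :=
  deriv Complex.Gamma z / Complex.Gamma z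

variable (N : ℕ) [NeZero N] (κ : ℤ)

/-- **`M₁(l,0,it) = Σ^h_{f ∈ H*_κ(N)} λ_f(l) L_f(1/2 + it)`** (the twisted first moment at `u = 0`,
`v = it`). [cite: BalkanovaFrolenkov2017, §1 (1.8)] -/
def M1 (l : ℕ) (t : ℝ) : ℂ :=
  harmonicSumC N κ fun f => heckeLambda f l * analyticL f (1 / 2 + (t : ℂ) * I)

/-- **`M₂(l,0,it) = Σ^h_{f ∈ H*_κ(N)} λ_f(l) L_f(1/2 + it) L_f(1/2 − it)`** (the twisted second moment
at `u = 0`, `v = it`). [cite: BalkanovaFrolenkov2017, §1 (1.9)] -/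
def M2 (l : ℕ) (t : ℝ) : ℂ :=
  harmonicSumC N κ fun f =>
    heckeLambda f l * analyticL f (1 / 2 + (t : ℂ) * I) * analyticL f (1 / 2 - (t : ℂ) * I)

/-- **The main term of Theorem 1.5** for `N = p^ν`, weight `2k`, `(l,p) = 1`:
`(φ(N)φ_ν(N)/N)·(τ_{it}(l)/l^{1/2})·(log N + 2γ − 2 log 2π + 2 log p/(p−1) + Γ′/Γ(k+it) + Γ′/Γ(k−it))`
`− (φ(N)φ_ν(N)/N)·l^{−(1/2−it)}·Σ_{d∣l} Σ_{r∣d} μ(d/r) τ_{it}(r) r^{−it} log r`.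
[cite: BalkanovaFrolenkov2017, Theorem 1.5] -/
def M2MainTerm (p ν k l : ℕ) (t : ℝ) : ℂ :=
  let N : ℕ := p ^ ν
  let A : ℂ := ((N.totient : ℝ) * phiNu p ν / N : ℝ)
  A * (tauIt t l / ((Real.sqrt l : ℝ) : ℂ)) *
      (((Real.log N + 2 * Real.eulerMascheroniConstant - 2 * Real.log (2 * Real.pi) +
          2 * Real.log p / ((p : ℝ) - 1) : ℝ) : ℂ) +
        digamma ((k : ℂ) + (t : ℂ) * I) + digamma ((k : ℂ) - (t : ℂ) * I)) -
    A * (l : ℂ) ^ (-(1 / 2 - (t : ℂ) * I)) *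
      ∑ d ∈ l.divisors, ∑ r ∈ d.divisors,
        (ArithmeticFunction.moebius (d / r) : ℂ) * tauIt t r * (r : ℂ) ^ (-((t : ℂ) * I)) *
          ((Real.log r : ℝ) : ℂ)

end BalkanovaFrolenkov2017

open BalkanovaFrolenkov2017

/-! ### The named facts -/

section Facts

open scoped Classical

/-- **Balkanova–Frolenkov 2018, Theorem 1.1, first clause (`p` fixed, `ν → ∞`).** "Let `N = p^ν`,
`p` is a fixed prime. For any `ε > 0`, `Σ^h_{f ∈ H*_{2k}(N), L_f(1/2) ≠ 0} 1 ≥ (φ(N)/N)·(1/4) − ε`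
as `ν → ∞`." For every `k ≥ 1` (weight `2k`), prime `p`, `ε > 0` there is `ν₀` with the harmonic
mass of `{f ∈ H*_{2k}(p^ν) : L_f(1/2) ≠ 0}` at least `(φ(N)/N)/4 − ε` for all `ν ≥ ν₀`
(`φ(N)/N = 1 − 1/p`). NAMED FACT, not proved here. [cite: BalkanovaFrolenkov2017, Theorem 1.1 (first display)] -/
def balkanovaFrolenkov2017_theorem11_nu : Prop :=
  ∀ (k : ℕ), 1 ≤ k → ∀ (p : ℕ), p.Prime → ∀ eps : ℝ, 0 < eps → ∃ ν₀ : ℕ,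
    ∀ (N ν : ℕ) [NeZero N], N = p ^ ν → ν₀ ≤ ν →
      (N.totient : ℝ) / N * (1 / 4) - eps ≤
        harmonicSum N (2 * k) (fun f => if centralValue f ≠ 0 then 1 else 0)

/-- **Balkanova–Frolenkov 2018, Theorem 1.1, second clause (`ν ≥ 2` fixed, `p → ∞` over
primes).** "Let `N = p^ν`, `ν ≥ 2` is fixed. For any `ε > 0`,
`Σ^h_{f ∈ H*_{2k}(N), L_f(1/2) ≠ 0} 1 ≥ 1/4 − ε` as `p → ∞` over primes." For every `k ≥ 1`,
`ν ≥ 2`, `ε > 0` there is `p₀` with the harmonic mass of `{f ∈ H*_{2k}(p^ν) : L_f(1/2) ≠ 0}` at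
least `1/4 − ε` for every prime `p ≥ p₀` — the Iwaniec–Sarnak barrier value `c = 1/4` reached for
prime-power level. NAMED FACT, not proved here.
[cite: BalkanovaFrolenkov2017, Theorem 1.1 (second display)] -/
def balkanovaFrolenkov2017_theorem11_p : Prop :=
  ∀ (k : ℕ), 1 ≤ k → ∀ (ν : ℕ), 2 ≤ ν → ∀ eps : ℝ, 0 < eps → ∃ p₀ : ℕ,
    ∀ (N p : ℕ) [NeZero N], p.Prime → N = p ^ ν → p₀ ≤ p →
      (1 / 4 : ℝ) - eps ≤ harmonicSum N (2 * k) (fun f => if centralValue f ≠ 0 then 1 else 0)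

/-- **Balkanova–Frolenkov 2018, Theorem 1.5 (= Theorem 1.1 of their second-moment paper).**
"Let `k ≥ 1`, `p` be a prime, `t ∈ ℝ`, `T := 3 + |t|`, `N = p^ν` and `ν ≥ 2`. If `p ∣ l` then
`M₂(l,0,it) = 0`. For `(l,p) = 1` we have `M₂(l,0,it) = [main term] + O_ε((lNT)^ε √l T/N)`"
(main term `M2MainTerm`, quoted in its docstring). Rendered: for every `k ≥ 1` and `ε > 0` a
constant `C` (it may depend on `k`, `ε`) with, for all primes `p`, `ν ≥ 2`, `N = p^ν`, real `t`,
`l ≥ 1`: `M₂ = 0` if `p ∣ l`, and `‖M₂(l,0,it) − MT‖ ≤ C (lNT)^ε √l T/N` if `(l,p) = 1`. The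
admissible logarithmic mollifier length this certifies is `Ω < 1/2` (the diagonal range). NAMED
FACT, not proved here. [cite: BalkanovaFrolenkov2017, Theorem 1.5] -/
def balkanovaFrolenkov2017_theorem15 : Prop :=
  ∀ (k : ℕ), 1 ≤ k → ∀ eps : ℝ, 0 < eps → ∃ C : ℝ,
    ∀ (N p ν : ℕ) [NeZero N], p.Prime → 2 ≤ ν → N = p ^ ν →
      ∀ (t : ℝ) (l : ℕ), 1 ≤ l →
        (p ∣ l → M2 N (2 * k) l t = 0) ∧
        (l.Coprime p →
          ‖M2 N (2 * k) l t - M2MainTerm p ν k l t‖ ≤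
            C * ((l : ℝ) * N * (3 + |t|)) ^ eps * Real.sqrt l * (3 + |t|) / N)

/-- **Balkanova–Frolenkov 2018, Theorem 1.6 (particular case of Bettin's Theorem 1.1), weight
`2`.** "Let `2k = 2`, `t ∈ ℝ`, `T = 1 + |t|`, `N = p^ν`, `p` is a prime … and `ν ≥ 2`. If `p ∣ l`
then `M₁(l,0,it) = 0`. For `(l,p) = 1` uniformly in `N`, `l`, `T`, `p`:
`M₁(l,0,it) = φ_ν(N)/l^{1/2+it} + O_ε(√(lT) N^{−1+ε})`." NAMED FACT, not proved here.
[cite: BalkanovaFrolenkov2017, Theorem 1.6] -/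
def balkanovaFrolenkov2017_theorem16 : Prop :=
  ∀ eps : ℝ, 0 < eps → ∃ C : ℝ,
    ∀ (N p ν : ℕ) [NeZero N], p.Prime → 2 ≤ ν → N = p ^ ν →
      ∀ (t : ℝ) (l : ℕ), 1 ≤ l →
        (p ∣ l → M1 N 2 l t = 0) ∧
        (l.Coprime p →
          ‖M1 N 2 l t - ((phiNu p ν : ℝ) : ℂ) / (l : ℂ) ^ (1 / 2 + (t : ℂ) * I)‖ ≤
            C * Real.sqrt ((l : ℝ) * (1 + |t|)) * (N : ℝ) ^ (-1 + eps))

/-- **Balkanova–Frolenkov 2018, Theorem 1.7, in its printed combined form (weight `2k ≥ 4`).**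
"Let `2k ≥ 4`, `t ∈ ℝ`, `T = 1 + |t|`, `N = p^ν`, `p` is a prime and `ν ≥ 2`. If `p ∣ l` then
`M₁(l,0,it) = 0`. For `(l,p) = 1` uniformly in `N, l, T, p` and `k`:
`M₁(l,0,it) = φ_ν(N)/l^{1/2+it} + O(V_N(l) + (1/p)V_{N/p}(l) + δ_{N,p²}/(√l p²))` … Combining the
last two estimates in one, we have `V_N(l) + (1/p)V_{N/p}(l) + δ_{N,p²}/(√l p²) ≪_{k,ε} l^{1/2+ε}T^{1/2+ε}/N`."
Rendered with the combined error: `∀ k ≥ 2, ∀ ε > 0, ∃ C = C(k,ε)` with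
`‖M₁(l,0,it) − φ_ν(N)/l^{1/2+it}‖ ≤ C·l^{1/2+ε}(1+|t|)^{1/2+ε}/N` for `(l,p) = 1` (admissible
logarithmic length `Ω < 1`). NAMED FACT, not proved here. [cite: BalkanovaFrolenkov2017, Theorem 1.7] -/
def balkanovaFrolenkov2017_theorem17 : Prop :=
  ∀ (k : ℕ), 2 ≤ k → ∀ eps : ℝ, 0 < eps → ∃ C : ℝ,
    ∀ (N p ν : ℕ) [NeZero N], p.Prime → 2 ≤ ν → N = p ^ ν →
      ∀ (t : ℝ) (l : ℕ), 1 ≤ l →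
        (p ∣ l → M1 N (2 * k) l t = 0) ∧
        (l.Coprime p →
          ‖M1 N (2 * k) l t - ((phiNu p ν : ℝ) : ℂ) / (l : ℂ) ^ (1 / 2 + (t : ℂ) * I)‖ ≤
            C * (l : ℝ) ^ (1 / 2 + eps) * (1 + |t|) ^ (1 / 2 + eps) / N)

end Facts

/-! ### Proved bookkeeping -/

/-- `φ_ν(p^ν) = 1 − 1/p` for `ν ≥ 3`. [cite: BalkanovaFrolenkov2017, §1 (display after Lemma 1.4)] -/
theorem BalkanovaFrolenkov2017.phiNu_of_three_le {p ν : ℕ} (hν : 3 ≤ ν) :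
    phiNu p ν = 1 - (p : ℝ)⁻¹ := by
  simp [phiNu, hν]

/-- `φ_ν(p²) = 1 − 1/(p − 1/p) = 1 − p/(p² − 1)`. [cite: BalkanovaFrolenkov2017, §1 (display after Lemma 1.4)] -/
theorem BalkanovaFrolenkov2017.phiNu_two (p : ℕ) :
    phiNu p 2 = 1 - ((p : ℝ) - (p : ℝ)⁻¹)⁻¹ := by
  simp [phiNu]

/-- For a prime power `N = p^ν`, `ν ≥ 1`: `φ(N)/N = 1 − 1/p` (the factor in Theorem 1.1's first
clause). [cite: BalkanovaFrolenkov2017, Theorem 1.1 (first display)] -/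
theorem BalkanovaFrolenkov2017.totient_div_prime_pow {p ν : ℕ} (hp : p.Prime) (hν : 1 ≤ ν) :
    ((p ^ ν).totient : ℝ) / (p ^ ν : ℕ) = 1 - (p : ℝ)⁻¹ := by
  rw [Nat.totient_prime_pow hp (by omega)]
  have hp0 : (p : ℝ) ≠ 0 := by exact_mod_cast hp.ne_zero
  obtain ⟨m, rfl⟩ : ∃ m, ν = m + 1 := ⟨ν - 1, by omega⟩
  push_cast [Nat.cast_pow, hp.one_le]
  rw [pow_succ]
  field_simp

/-- Theorem 1.1's two clauses have the SAME limiting proportion `1/4 · (1 − 1/p)` at fixed `p`; as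
`p → ∞` this is the Iwaniec–Sarnak value `1/4` ("the value `c = 1/4` is a natural barrier").
[cite: BalkanovaFrolenkov2017, Theorem 1.1] -/
theorem BalkanovaFrolenkov2017.quarter_barrier (p : ℝ) (hp : 0 < p) :
    (1 - p⁻¹) * (1 / 4 : ℝ) ≤ 1 / 4 := by
  have : 0 < p⁻¹ := inv_pos.mpr hp
  nlinarith

end Literature.NumberTheory.LFunctions
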